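import Mathlib
import Literature.Analysis.FluidPDE.Tao2016AveragedNS.RestartedCascadeFlows
import HarnessLib

/-!
# `GappedFrontRobust`, the (step) clause: PER-SHELL BUDGETS below the tail (the envelope bound (D2) and the
  motion-defect bound (D1) of the K_B₂ assembly from a uniform device; helper for item
  stmt-NavierStokesRegularity-22114 `GappedFrontRobustV2`)

HONEST FRAMING: elementary real-number bookkeeping; nothing is asserted about any table or flow; nothing
here concerns the Navier–Stokes equations. With `q = 1+ε₀ > 1` and `X_n = 1 + q^{−n}`: the exact flow's
envelope obeys `A⁰ n ≤ A_unif X_n` on every shell (`A0_le_unif` from its three-piece shape), the weights obey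
`q^{s n} w(n−1) ≤ C_T q + q^{s k₂} W₂` for `n < k₂`, `s ≥ 1` (`rpow_mul_weight_le`, `TameBehind` behind, a finite
sum `W₂ ≥ w_j` on `[0, k₂]` ahead), and then for every compared shell `n < k₂`
(D2) `3 ((A⁰ n + 2ψ D n)²/2 + η Csw q^{−(1/2+θ)n}) ≤ (6 (A_unif + 2r)² + 12) q^{2(k₂−n)}` and
(D1) `c η q^{2n} √(…) ≤ ψ₀ D n / 4`, provided `ψ ≤ 1`, `η Csw ≤ 1`, `D n = r/w(n−1)`, `w ≥ 1`, `0 ≤ θ ≤ 3/2` and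
`η · 4 c √(6 (A_unif+2r)² + 12) q^{k₂} (C_T q + q^{k₂} W₂) ≤ ψ₀ r`.
-/

noncomputable section

-- the sub-problem namespace `Summit.NavierStokesRegularity.NavierStokesRegularity` repeats the summit name by design (D-0017)
set_option linter.dupNamespace false

namespace Summit.NavierStokesRegularity.NavierStokesRegularity.Theorems

open Set Literature.Analysis.FluidPDE Literature.Analysis.FluidPDE.TaoCascade

namespace GappedFrontRobust

/-- A term of a finite sum of nonnegative reals over an integer interval is at most the sum. [folklore] -/
theorem le_sum_Icc_of_mem {w : ℤ → ℝ} (hw : ∀ k, 0 ≤ w k) {a b j : ℤ} (ha : a ≤ j) (hb : j ≤ b) :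
    w j ≤ ∑ i ∈ Finset.Icc a b, w i :=
  Finset.single_le_sum (f := w) (fun i _ => hw i) (Finset.mem_Icc.mpr ⟨ha, hb⟩)

/-- **Weights against rates below the tail**: if `w ≥ 0`, `w k ≤ C_T q^{−k}` for `k ≤ 0` (`TameBehind`), `q ≥ 1`,
`s ≥ 1`, and `W₂ ≥ w j` for `0 ≤ j ≤ k₂` (`W₂ ≥ 0`), then `q^{s n} w(n−1) ≤ C_T q + q^{s k₂} W₂` for every
`n < k₂`. [folklore] -/
theorem rpow_mul_weight_le {q C_T W₂ s : ℝ} {w : ℤ → ℝ} {k₂ : ℤ} (hq : 1 ≤ q) (hCT : 0 ≤ C_T) (hW₂ : 0 ≤ W₂)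
    (hs : 1 ≤ s) (hw0 : ∀ k, 0 ≤ w k)
    (hwT : ∀ k : ℤ, k ≤ 0 → w k ≤ C_T * q ^ (-(k : ℝ)))
    (hW : ∀ j : ℤ, 0 ≤ j → j ≤ k₂ → w j ≤ W₂) {n : ℤ} (hn : n < k₂) :
    q ^ (s * n) * w (n - 1) ≤ C_T * q + q ^ (s * k₂) * W₂ := by
  have hq0 : 0 < q := by linarith
  have hqs : 0 ≤ q ^ (s * n) := (Real.rpow_pos_of_pos hq0 _).le
  have hqk : 0 ≤ q ^ (s * k₂) := (Real.rpow_pos_of_pos hq0 _).le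
  rcases le_or_gt n 0 with hn0 | hn0
  · -- behind: w(n-1) ≤ C_T q^{1-n}, q^{sn} q^{1-n} = q^{1+(s-1)n} ≤ q
    have hnr : (n : ℝ) ≤ 0 := by exact_mod_cast hn0
    have h1 := hwT (n - 1) (by linarith)
    have h2 : q ^ (s * n) * (C_T * q ^ (-(((n - 1 : ℤ)) : ℝ))) = C_T * q ^ (1 + (s - 1) * n) := by
      rw [mul_left_comm, ← Real.rpow_add hq0]; push_cast; ring_nf
    have h3 : q ^ (1 + (s - 1) * n) ≤ q := by
      calc q ^ (1 + (s - 1) * n) ≤ q ^ (1 : ℝ) := Real.rpow_le_rpow_of_exponent_le hq (by nlinarith)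
        _ = q := Real.rpow_one q
    calc q ^ (s * n) * w (n - 1) ≤ q ^ (s * n) * (C_T * q ^ (-(((n - 1 : ℤ)) : ℝ))) :=
          mul_le_mul_of_nonneg_left h1 hqs
      _ = C_T * q ^ (1 + (s - 1) * n) := h2
      _ ≤ C_T * q := mul_le_mul_of_nonneg_left h3 hCT
      _ ≤ C_T * q + q ^ (s * k₂) * W₂ := by nlinarith
  · -- ahead: q^{sn} ≤ q^{s k₂}, w(n-1) ≤ W₂
    have hnr : (n : ℝ) ≤ k₂ := by exact_mod_cast hn.le
    have h1 : q ^ (s * n) ≤ q ^ (s * k₂) := Real.rpow_le_rpow_of_exponent_le hq (by nlinarith)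
    have h2 := hW (n - 1) (by linarith) (by linarith)
    calc q ^ (s * n) * w (n - 1) ≤ q ^ (s * k₂) * W₂ := mul_le_mul h1 h2 (hw0 _) hqk
      _ ≤ C_T * q + q ^ (s * k₂) * W₂ := by nlinarith

/-- **The exact envelope against the uniform device**: from its three-piece shape
(`A⁰ k ≤ C_A q^{−k}` for `k ≤ kb+2`, `A⁰ k ≤ A_mid` for `kb+1 ≤ k`; `C_A, A_mid ≥ 0`, `q > 0`),
`A⁰ n ≤ (C_A + A_mid)(1 + q^{−n})` on every shell. [folklore] -/
theorem A0_le_unif {q C_A A_mid : ℝ} {A₀ : ℤ → ℝ} {kb : ℤ} (hq : 0 < q) (hCA : 0 ≤ C_A)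
    (hAmid : 0 ≤ A_mid) (hA_lo : ∀ k : ℤ, k ≤ kb + 2 → A₀ k ≤ C_A * q ^ (-(k : ℝ)))
    (hA_mid : ∀ k : ℤ, kb + 1 ≤ k → A₀ k ≤ A_mid) (n : ℤ) :
    A₀ n ≤ (C_A + A_mid) * (1 + q ^ (-(n : ℝ))) := by
  have hx : 0 ≤ q ^ (-(n : ℝ)) := (Real.rpow_pos_of_pos hq _).le
  rcases le_or_gt n (kb + 2) with hn | hn
  · have := hA_lo n hn; nlinarith
  · have := hA_mid n (by linarith); nlinarith

/-- **(D2) the envelope budget below the tail.** [folklore] -/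
theorem budget_envelope {q r θ ψ η Csw A_unif : ℝ} {A₀ D w : ℤ → ℝ} {k₂ : ℤ} (hq : 1 ≤ q)
    (hr : 0 ≤ r) (hθ : 0 ≤ θ) (hθ' : θ ≤ 3 / 2) (hψ0 : 0 ≤ ψ) (hψ1 : ψ ≤ 1)
    (hηC : η * Csw ≤ 1) (hk₂ : 0 ≤ k₂) (hw1 : ∀ k, 1 ≤ w k)
    (hD : ∀ k, D k = r / w (k - 1)) (hA0 : ∀ k, 0 ≤ A₀ k)
    (hAunif : ∀ n : ℤ, A₀ n ≤ A_unif * (1 + q ^ (-(n : ℝ)))) {n : ℤ} (hn : n < k₂) :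
    3 * ((A₀ n + 2 * ψ * D n) ^ 2 / 2 + η * (Csw * q ^ (-((1 / 2 + θ) * n)))) ≤
      (6 * (A_unif + 2 * r) ^ 2 + 12) * q ^ ((2 : ℝ) * (k₂ - n)) := by
  have hq0 : 0 < q := by linarith
  set X : ℝ := 1 + q ^ (-(n : ℝ)) with hX
  have hx0 : 0 ≤ q ^ (-(n : ℝ)) := (Real.rpow_pos_of_pos hq0 _).le
  have hX1 : 1 ≤ X := by simp only [hX]; linarith
  have hw : ∀ k, 0 < w k := fun k => lt_of_lt_of_le one_pos (hw1 k)
  -- D n ≤ r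
  have hDn : D n ≤ r := by rw [hD n]; exact div_le_self hr (hw1 _)
  have hDn0 : 0 ≤ D n := by rw [hD n]; exact div_nonneg hr (hw _).le
  -- a_n ≤ (A_unif + 2r) X
  have ha : A₀ n + 2 * ψ * D n ≤ (A_unif + 2 * r) * X := by
    have h1 := hAunif n
    have h2 : 2 * ψ * D n ≤ 2 * r * X := by
      calc 2 * ψ * D n ≤ 2 * 1 * r := by
            have := mul_le_mul hψ1 hDn hDn0 zero_le_one; nlinarith
        _ ≤ 2 * r * X := by nlinarith
    simp only [hX] at h2 ⊢; nlinarith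
  have ha0 : 0 ≤ A₀ n + 2 * ψ * D n := by have := hA0 n; positivity
  have ha2 : (A₀ n + 2 * ψ * D n) ^ 2 ≤ (A_unif + 2 * r) ^ 2 * X ^ 2 := by
    rw [← mul_pow]; exact pow_le_pow_left₀ ha0 ha 2
  -- the slack term ≤ X²
  have hs : η * (Csw * q ^ (-((1 / 2 + θ) * n))) ≤ X ^ 2 := by
    have h1 : q ^ (-((1 / 2 + θ) * n)) ≤ X ^ 2 := by
      rcases le_or_gt (n : ℝ) 0 with hn0 | hn0
      · -- q^{-(1/2+θ)n} ≤ q^{-2n} ≤ X²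
        have h2 : q ^ (-((1 / 2 + θ) * n)) ≤ q ^ (-(2 : ℝ) * n) :=
          Real.rpow_le_rpow_of_exponent_le hq (by nlinarith)
        have h3 : q ^ (-(2 : ℝ) * n) = (q ^ (-(n : ℝ))) ^ 2 := by
          rw [← Real.rpow_natCast, ← Real.rpow_mul hq0.le]; ring_nf
        rw [h3] at h2
        have h4 : (q ^ (-(n : ℝ))) ^ 2 ≤ X ^ 2 := pow_le_pow_left₀ hx0 (by linarith) 2
        exact h2.trans h4
      · have h2 : q ^ (-((1 / 2 + θ) * n)) ≤ 1 :=
          Real.rpow_le_one_of_one_le_of_nonpos hq (by nlinarith)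
        nlinarith
    have h2 : 0 ≤ q ^ (-((1 / 2 + θ) * n)) := (Real.rpow_pos_of_pos hq0 _).le
    calc η * (Csw * q ^ (-((1 / 2 + θ) * n))) = (η * Csw) * q ^ (-((1 / 2 + θ) * n)) := by ring
      _ ≤ 1 * q ^ (-((1 / 2 + θ) * n)) := mul_le_mul_of_nonneg_right hηC h2
      _ ≤ X ^ 2 := by linarith
  -- X² ≤ 4 q^{2(k₂ - n)}
  have hX2 : X ^ 2 ≤ 4 * q ^ ((2 : ℝ) * (k₂ - n)) := by
    have hnr : (n : ℝ) ≤ k₂ := by exact_mod_cast hn.le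
    have hk₂r : (0 : ℝ) ≤ k₂ := by exact_mod_cast hk₂
    have h1 : (1 : ℝ) ≤ q ^ ((2 : ℝ) * (k₂ - n)) := Real.one_le_rpow hq (by nlinarith)
    have h2 : q ^ (-(n : ℝ)) ≤ q ^ ((k₂ : ℝ) - n) := Real.rpow_le_rpow_of_exponent_le hq (by linarith)
    have h3 : (q ^ ((k₂ : ℝ) - n)) ^ 2 = q ^ ((2 : ℝ) * (k₂ - n)) := by
      rw [← Real.rpow_natCast, ← Real.rpow_mul hq0.le]; ring_nf
    have h4 : (q ^ (-(n : ℝ))) ^ 2 ≤ q ^ ((2 : ℝ) * (k₂ - n)) := by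
      rw [← h3]; exact pow_le_pow_left₀ hx0 h2 2
    have h5 : X ^ 2 ≤ 2 * (1 + (q ^ (-(n : ℝ))) ^ 2) := by
      simp only [hX]; nlinarith [sq_nonneg (1 - q ^ (-(n : ℝ)))]
    nlinarith
  have hq2 : 0 ≤ q ^ ((2 : ℝ) * (k₂ - n)) := (Real.rpow_pos_of_pos hq0 _).le
  have hAr : 0 ≤ (A_unif + 2 * r) ^ 2 := sq_nonneg _
  calc 3 * ((A₀ n + 2 * ψ * D n) ^ 2 / 2 + η * (Csw * q ^ (-((1 / 2 + θ) * n))))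
      ≤ 3 * ((A_unif + 2 * r) ^ 2 * X ^ 2 / 2 + X ^ 2) := by nlinarith
    _ = (3 / 2 * (A_unif + 2 * r) ^ 2 + 3) * X ^ 2 := by ring
    _ ≤ (3 / 2 * (A_unif + 2 * r) ^ 2 + 3) * (4 * q ^ ((2 : ℝ) * (k₂ - n))) :=
        mul_le_mul_of_nonneg_left hX2 (by positivity)
    _ = (6 * (A_unif + 2 * r) ^ 2 + 12) * q ^ ((2 : ℝ) * (k₂ - n)) := by ring

/-- **(D1) the motion-defect budget below the tail.** With the data of `budget_envelope`, the weight bound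
`q^{n} w(n−1) ≤ Ω₁` for `n < k₂` and the margin condition `η · (4 c √(6 (A_unif+2r)² + 12) q^{k₂} Ω₁) ≤ ψ₀ r`
(`c ≥ 0`): `c (η q^{2n} √(3 ((A⁰ n + 2ψ D n)²/2 + η Csw q^{−(1/2+θ)n}))) ≤ ψ₀ D n / 4` for every `n < k₂`.
[folklore] -/
theorem budget_defect {q r θ ψ η Csw A_unif c ψ₀ Ω₁ : ℝ} {A₀ D w : ℤ → ℝ} {k₂ : ℤ} (hq : 1 ≤ q)
    (hr : 0 ≤ r) (hθ : 0 ≤ θ) (hθ' : θ ≤ 3 / 2) (hψ0 : 0 ≤ ψ) (hψ1 : ψ ≤ 1) (hη : 0 ≤ η)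
    (hηC : η * Csw ≤ 1) (hk₂ : 0 ≤ k₂) (hw1 : ∀ k, 1 ≤ w k)
    (hD : ∀ k, D k = r / w (k - 1)) (hA0 : ∀ k, 0 ≤ A₀ k)
    (hAunif : ∀ n : ℤ, A₀ n ≤ A_unif * (1 + q ^ (-(n : ℝ)))) (hc : 0 ≤ c)
    (hΩ₁ : ∀ n : ℤ, n < k₂ → q ^ ((1 : ℝ) * n) * w (n - 1) ≤ Ω₁)
    (hηψ : η * (4 * c * Real.sqrt (6 * (A_unif + 2 * r) ^ 2 + 12) * q ^ (k₂ : ℝ) * Ω₁) ≤ ψ₀ * r)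
    {n : ℤ} (hn : n < k₂) :
    c * (η * q ^ ((2 : ℝ) * n) *
      Real.sqrt (3 * ((A₀ n + 2 * ψ * D n) ^ 2 / 2 + η * (Csw * q ^ (-((1 / 2 + θ) * n)))))) ≤
      ψ₀ * D n / 4 := by
  have hq0 : 0 < q := by linarith
  have hw : ∀ k, 0 < w k := fun k => lt_of_lt_of_le one_pos (hw1 k)
  have hwn := hw (n - 1)
  set E : ℝ := 6 * (A_unif + 2 * r) ^ 2 + 12 with hE
  have hE0 : 0 ≤ E := by positivity
  have h2 := budget_envelope hq hr hθ hθ' hψ0 hψ1 hηC hk₂ hw1 hD hA0 hAunif hn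
  -- √(…) ≤ √E q^{k₂ - n}
  have hsq : Real.sqrt (3 * ((A₀ n + 2 * ψ * D n) ^ 2 / 2 + η * (Csw * q ^ (-((1 / 2 + θ) * n))))) ≤
      Real.sqrt E * q ^ ((k₂ : ℝ) - n) := by
    have h3 : E * q ^ ((2 : ℝ) * (k₂ - n)) = (Real.sqrt E * q ^ ((k₂ : ℝ) - n)) ^ 2 := by
      rw [mul_pow, Real.sq_sqrt hE0, ← Real.rpow_natCast (q ^ ((k₂ : ℝ) - n)), ← Real.rpow_mul hq0.le]
      ring_nf
    calc _ ≤ Real.sqrt (E * q ^ ((2 : ℝ) * (k₂ - n))) := Real.sqrt_le_sqrt h2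
      _ = Real.sqrt E * q ^ ((k₂ : ℝ) - n) := by
          rw [h3, Real.sqrt_sq (by have := Real.rpow_pos_of_pos hq0 ((k₂ : ℝ) - n); positivity)]
  -- q^{2n} q^{k₂ - n} = q^{k₂} q^{n}
  have hpow : q ^ ((2 : ℝ) * n) * q ^ ((k₂ : ℝ) - n) = q ^ (k₂ : ℝ) * q ^ ((1 : ℝ) * n) := by
    rw [← Real.rpow_add hq0, ← Real.rpow_add hq0]; ring_nf
  have hΩ := hΩ₁ n hn
  have hq2n : 0 ≤ q ^ ((2 : ℝ) * n) := (Real.rpow_pos_of_pos hq0 _).le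
  have hqk : 0 ≤ q ^ (k₂ : ℝ) := (Real.rpow_pos_of_pos hq0 _).le
  have hq1n : 0 ≤ q ^ ((1 : ℝ) * n) := (Real.rpow_pos_of_pos hq0 _).le
  rw [hD n]
  -- multiply the target by 4 w(n-1) > 0
  rw [show ψ₀ * (r / w (n - 1)) / 4 = ψ₀ * r / (4 * w (n - 1)) by ring]
  rw [le_div_iff₀ (by positivity)]
  calc c * (η * q ^ ((2 : ℝ) * n) *
        Real.sqrt (3 * ((A₀ n + 2 * ψ * (r / w (n - 1))) ^ 2 / 2 + η * (Csw * q ^ (-((1 / 2 + θ) * n)))))) *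
        (4 * w (n - 1))
      ≤ c * (η * q ^ ((2 : ℝ) * n) * (Real.sqrt E * q ^ ((k₂ : ℝ) - n))) * (4 * w (n - 1)) := by
        rw [← hD n]
        have : 0 ≤ 4 * w (n - 1) := by positivity
        refine mul_le_mul_of_nonneg_right (mul_le_mul_of_nonneg_left ?_ hc) this
        exact mul_le_mul_of_nonneg_left hsq (mul_nonneg hη hq2n)
    _ = η * (4 * c * Real.sqrt E * q ^ (k₂ : ℝ)) * (q ^ ((1 : ℝ) * n) * w (n - 1)) := by
        have : η * q ^ ((2 : ℝ) * n) * (Real.sqrt E * q ^ ((k₂ : ℝ) - n)) =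
            η * Real.sqrt E * (q ^ ((2 : ℝ) * n) * q ^ ((k₂ : ℝ) - n)) := by ring
        rw [this, hpow]; ring
    _ ≤ η * (4 * c * Real.sqrt E * q ^ (k₂ : ℝ)) * Ω₁ := by
        refine mul_le_mul_of_nonneg_left hΩ ?_; positivity
    _ = η * (4 * c * Real.sqrt E * q ^ (k₂ : ℝ) * Ω₁) := by ring
    _ ≤ ψ₀ * r := hηψ

end GappedFrontRobust

end Summit.NavierStokesRegularity.NavierStokesRegularity.Theorems

end
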